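import Literature.MathematicalPhysics.QuantumFieldTheory.ConformalBootstrap3D.PointKernelK34L505Data
import Literature.MathematicalPhysics.QuantumFieldTheory.ConformalBootstrap3D.PointKernelK34L505Segs
import Literature.MathematicalPhysics.QuantumFieldTheory.ConformalBootstrap3D.PointKernelParts

/-!
# K34L505 certificate, kernel part file P2: one-cell head segments 24, 53 in level ranges

The head cells whose kernel evaluation exceeds one `decide` are one-cell segments of `hsegsK34L505`; each is
checked by `PCert.hPartSideOK` (side conditions) and `PCert.hPartOK` per level range `[n_lo, n_lo + count)`
against an integer claim, the claims summing to `≥ 0` (`PointKernel.partsOK`); soundness is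
`PCert.hParts_sound` (`PointKernelParts`).  The part files are mutually independent (each imports only
the data file); the ranges of one cell may span several of them, and the per-cell conclusions
`hparts_i` / `hcell_i` of those cells are assembled in `PointKernelK34L505.lean`.
Estimated kernel time 219 s.
-/

set_option maxRecDepth 100000
set_option maxHeartbeats 0

namespace Literature.MathematicalPhysics.QuantumFieldTheory.ConformalBootstrap3D.PointKernelK34L505

open Literature.MathematicalPhysics.QuantumFieldTheory.ConformalBootstrap3D.PointKernel

/-- levels `[0, 35)` of segment 24: partial lower sum `≥` claim. [folklore] -/
theorem part_24_0 : certK34L505.hPartOK (PCert.segAt hsegsK34L505 24) JHK34L505 0 35 (-24471405874046219673404338517337968) = true := by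
  decide +kernel

/-- levels `[35, 37)` of segment 24: partial lower sum `≥` claim. [folklore] -/
theorem part_24_1 : certK34L505.hPartOK (PCert.segAt hsegsK34L505 24) JHK34L505 35 2 (24471405874046219673404338517337969) = true := by
  decide +kernel

/-- one-cell segment 53 (row 4, cell `[5, 40961/8192]`, chord, `n_F = 74`,
11 level ranges): side conditions. [folklore] -/
theorem pside_53 : certK34L505.hPartSideOK (PCert.segAt hsegsK34L505 53) JHK34L505 = true := by
  decide +kernel

/-- its level ranges `(n_lo, count, claim)`. [folklore] -/
def partsK34L505_53 : List (ℕ × ℕ × ℤ) := [(0, 26, -3251757413518647827173180864460808374), (26, 11, 2177386364006422083911166125965012475), (37, 8, 651645139516058876462832945454600492), (45, 6, 221073125500192414597913080022236039), (51, 5, 96818779459945572970617072263866992), (56, 4, 45230377953488708709428124559846310), (60, 4, 28057508629412517926733802089769082), (64, 4, 17270607850838394354754753403751988), (68, 3, 8110217223492616482114176281484111), (71, 3, 5445766518659106075346804311911697), (74, 1, 719526860137535682273980108329190)]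

/-- the ranges tile `[0, n_F]` and the claims sum to `≥ 0`. [folklore] -/
theorem pcov_53 : PointKernel.partsOK 74 partsK34L505_53 = true := by
  decide +kernel

/-- levels `[0, 26)` of segment 53: partial lower sum `≥` claim. [folklore] -/
theorem part_53_0 : certK34L505.hPartOK (PCert.segAt hsegsK34L505 53) JHK34L505 0 26 (-3251757413518647827173180864460808374) = true := by
  decide +kernel

/-- levels `[26, 37)` of segment 53: partial lower sum `≥` claim. [folklore] -/
theorem part_53_1 : certK34L505.hPartOK (PCert.segAt hsegsK34L505 53) JHK34L505 26 11 (2177386364006422083911166125965012475) = true := by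
  decide +kernel

end Literature.MathematicalPhysics.QuantumFieldTheory.ConformalBootstrap3D.PointKernelK34L505
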